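import Literature.NumberTheory.GelbartRogawski1991.WeilRepresentationsAPackets
import Literature.NumberTheory.GelbartRogawski1991.LocalAPackets
import HarnessLib

/-!
# Gelbart–Rogawski 1991, §1.2–§1.4 (p. 450): the squad's ONE posited `L`-function ∕ endoscopy datum `EndoscopicLData X`
# over the ★ dictionaries `X : GR91Spectrum` (global) and `GR91LocalPacket` (at each place) — places and local components,
# Hecke characters of `E` and `F`, `ν ↦ ν_E`, base change `π ↦ π_E`, `L(s, π ⊗ ξ) := L(s, π_E ⊗ ξ)` (§1.3, DEFINED), `L_E`,
# `L_F`, partial and local factors, `ε(s, ·)`, the endoscopic packets `Π(ϱ)` (`dim ϱ ≠ 1`) and their local packets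

S. Gelbart, J. Rogawski, *L-functions and Fourier–Jacobi coefficients for the unitary group `U(3)`*, Invent. Math. **105**
(1991) 445–472 [GelbartRogawski1991], §1.2–§1.4 p. 450 (read on the GDZ page image `img_p450.jpg`, PPN356556735_0105; cell
copy `pub-hodgecm-cf-rogawski-g6/lit/GR91-invent105/`).  Carpet-typing squad TG (cell hodgecm-mathlib), seat TG-t05, squad
ruling 2 (A): this file is the SHARED CARRIER imported by the section carpets `Sec1.lean` (§1 sentences: `lFactorisation`,
…), `Sec4.lean` (Shimura integral, (5.1.2)), `Sec5Defs.lean`∕`Sec5.lean` ((5.1.1)₁ `eq511L`, Prop. 5.2.1, Cor. 5.2.2),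
`Sec6.lean` (Thm. 6.1.1); namespace `Literature.NumberTheory.GelbartRogawski1991.Sec1Defs`.

DATUM ONLY (discipline of ★ `GR91Spectrum`): ONE structure whose fields are the carriers and primitives the printed
sentences of §§1, 4, 5, 6 speak about (field list = the squad's needs lists, TG-t02∕t03∕t04, name for name), plus the
definitional abbreviations of §1.3 (`Lstd`, `LstdS`, `Lstdv`: «`L(s, π ⊗ ξ)` is, by definition, `L(s, π_E ⊗ ξ)`»).  **No
predicate, no theorem, no `sorry`, no axiom, no instance, no notation; NOTHING is asserted** — the printed sentences are
`Prop`-valued predicates in the section files, taken by consumers as explicit hypotheses; the coherence of the local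
components with the ★ local dictionaries (`μ_v`, split∕finite flags, the ★ action) is likewise stated in `Sec1.lean`, not
assumed.  The groups of Hecke characters of `E` and of `F` are typeclass BINDERS `[CommGroup HeckeE] [CommGroup HeckeF]`
(pointwise products `μξ`, `η_Eξ`, `ξ_F ω_{E/F}` of the printed formulas), not declared instances.

SCOPE (§1.1 p. 449): `E/F` quadratic extension of NUMBER FIELDS, `G` = the quasi-split `U(3)` of `Φ`, `μ` and `ξ_H` fixed
(§1.4) — the fixed data of `X : GR91Spectrum`.

PARALLEL (honest Euler-product level, not used here): ★ `Literature/NumberTheory/Automorphic/AutomorphicLFunction.lean`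
(`Literature.NumberTheory.Automorphic.partialStandardL` — the partial standard `L`-function of a Satake family as a `tprod` over
`v ∉ S` — and `StandardLFunctionData.L`, `L(s, Π) = ∏_v P_v(q_v^{-s})⁻¹`) is where an instantiation of the sockets
`LGL3E ∕ LGL3ES ∕ LGL3Ev` (and the identity `L_S = ∏_{v ∉ S} L_v`) would come from; ★
`Rogawski1990.Ch13Sec3.GlobalBaseChange.psiG` is the parallel of `bcG`; ★ `GR91Spectrum.res1` (`γ ↦ γ¹`) is `res1 ∘ ofOmega`
— the coherence predicates are stated in `Sec1.lean` (`EndoscopicLData.Coherent`).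

## References
* [GelbartRogawski1991] Invent. Math. 105 (1991): §1.2 p. 450 L13–14 (`ν_E`), §1.3 p. 450 L15–19 (`π_E`, `L(s, π ⊗ ξ)`),
  §1.4 p. 450 L20–35 (`μ`, `H`, `Π(ϱ)`, `ϱ_{jE}`), Introduction p. 446 L9–11 (`ε(½, φ)`), L24–27 (`L_S(s, π ⊗ ξ)`, «the partial
  `L`-function with respect to a finite set of places `S`»), p. 447 L15 («cuspidal `L`-packet on `H`»); §5.1 (5.1.2) p. 465
  (`L_S(2s + 1, ξ_F)`).
* [Rogawski1990] Ann. of Math. Stud. 123 (= [R]): §13.3 p. 202 (`ψ_G`, the base change; tree ★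
  `Literature.NumberTheory.Rogawski1990.Ch13Sec3.GlobalBaseChange.psiG`).
-/

noncomputable section

namespace Literature.NumberTheory.GelbartRogawski1991.Sec1Defs

universe u

/-- **`EndoscopicLData X HeckeE` — the posited GLOBAL `L`-function ∕ endoscopy datum of §1.2–§1.4** over the ★ dictionary
`X : GR91Spectrum` (quasi-split `G = U(3)` of `E/F`, `μ`, `ξ_H` fixed) and a commutative group `HeckeE` of «Hecke characters
`ξ` of `E`» (p. 450 L16).  Fields = carriers and primitives of the printed sentences; NOTHING asserted.  Intended meaning:
* `Place` — the places `v` of `F`; `IsSplitPlace v` — «`v` is split (resp., non-split) if `v` splits (resp., remains prime) in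
  `E`» (§1.1 p. 449); `IsFinitePlace v` — «`v` is finite» (p. 451 L2; «archimedean» = not finite);
* `loc v` — the ★ LOCAL dictionary `GR91LocalPacket` at `v` (`G_v`, `μ_v`, `Π(ϱ_v) = {πⁿ(ϱ_v), πˢ(ϱ_v)}`, `ω(γ_v, ψ_v, χ_v)`), and
  the local-component maps `comp π v = π_v` («`π = ⊗π_v`», p. 451 L6), `locChar η v = η_v`, `locOmega γ v = γ_v` (`μ_v`),
  `locAdd ψ v = ψ_v`; their coherence with `loc v`'s own `mu`, `IsSplit`, `IsFinite` is STATED in `Sec1.lean`, not assumed;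
* `ofOmega γ` — a Hecke character `γ` of `I_E` with `γ|_{I_F} = ω_{E/F}` (★ `X.OmegaHecke`, e.g. `μ`) IS a Hecke character of `E`;
* `bc1 ν = ν_E` — §1.2 «If `ν` is a character of `E¹` …, we define a character `ν_E` of `E*` by `ν_E(α) = ν(α/ᾱ)`. It is the
  base change of `ν` to `GL_{1/E}`» (a homomorphism: `(νν′)_E = ν_E ν′_E`);
* `res1 ξ = ξ¹` — «the restriction of `ξ` to the norm one elements» (p. 465 L21), an automorphic character of `U(1)`;
* `HeckeF` (binder), `resF ξ = ξ_F` («`ξ_F`» = the restriction of `ξ` to `I_F`, (5.1.2) p. 465), `omegaEF = ω_{E/F}` («the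
  character `ω_{E/F}` associated to `E/F` by class field theory», p. 450 L21);
* `RepGL3E`, `RepGL2E` — irreducible representations of `GL₃(𝔸_E)`, `GL₂(𝔸_E)` up to isomorphism; `IsAutomorphicGL3E`,
  `IsAutomorphicGL2E` — «is an automorphic representation of `GL_{j/E}`»;
* `bcG π = π_E` — §1.3 «Let `π` be a discrete representation of `G`. The base change `π_E` of `π` to `GL_{3/E}` … ([R])»
  (total; meaningful on discrete `π`);
* `LGL3E Π ξ s = L(s, Π ⊗ ξ)` — «the `GL₃` `L`-function»; `LGL2E` likewise; `LHecke χ s = L_E(s, χ)` (the `L_E` of p. 465),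
  `LF χ′ s = L(s, χ′)` for a Hecke character `χ′` of `F` (the `L_S(2s+1, ξ_F)` of (5.1.2) unrestricted); values in `ℂ`,
  poles are junk values (the printed pole statements are about Eisenstein series, §4);
* `LGL3ES S Π ξ s = L_S(s, Π ⊗ ξ)`, `LHeckeS S χ s`, `LFS S χ′ s` — «the partial `L`-function with respect to a finite set of
  places `S`» (p. 446 L26–27; Euler product over `v ∉ S`); `LGL3Ev v`, `LHeckev v`, `LFv v` — the local factors at `v` (proof
  of Thm. 4.3.1, p. 464);
* `eps χ s = ε(s, χ)` — the `ε`-factor of a Hecke character of `E` («`ε(½, φ)`», p. 446 L10);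
* `IsCuspidal π` — «cuspidal» (p. 446 L24; Thm. 6.1.1);
* `PacketU2` — «an `L`-packet `ϱ₂` on `U(2)`» («an `L`-packet `ϱ` on `H` is of the form `ϱ = ϱ₂ × ϱ₁`, where `ϱ_j` is an
  `L`-packet on `U(j)`. Of course, an `L`-packet on `U(1)` consists of a single automorphic character» — `ϱ₁ ∈ X.Char1`);
  `IsDiscreteU2` («discrete `L`-packets on `H`»), `IsCuspidalU2` («`ϱ = ϱ₂ ⊗ ϱ₁` … a cuspidal `L`-packet on `H`», p. 447 L15),
  `IsOneDimU2` (`dim ϱ = 1` iff `dim ϱ₂ = 1`); `twistDetU2 ϱ₂ ν = ϱ₂ ⊗ (ν ∘ det)` (Lem. 6.2.2, p. 469);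
* `bcU2 ϱ₂ = ϱ_{2E}` — «`ϱ_{jE}` denotes the base change lift of `ϱ_j` to `GL_{j/E}`» (`j = 2`; for `j = 1` it is `bc1`);
* `packetL ϱ₂ ϱ₁ = Π(ϱ)` — «If `dim(ϱ) ≠ 1`, we denote by `Π(ϱ)` the `L`-packet on `G` corresponding to `ϱ` with respect to
  `ξ_H`» (set of members; for `dim ϱ = 1` the A-packet is ★ `X.packetA` and this field is unused); `locPacketL v ϱ₂ ϱ₁ = Π(ϱ_v)`
  its local packet at `v` («an `L`-packet `Π` on `G` is a "tensor product" `⊗Π_v` of local `L`-packets», p. 450 L26–27).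
[cite: GelbartRogawski1991, §1.1 p. 449 L21–23; §1.2–§1.4 p. 450 L13–40, p. 451 L1–6; Introduction p. 446 L9–11, L24–27; §5.1 (5.1.2) p. 465 L21, L33] -/
structure EndoscopicLData (X : GR91Spectrum.{u}) (HeckeE HeckeF : Type u) [CommGroup HeckeE] [CommGroup HeckeF] :
    Type (u + 1) where
  /-- the places `v` of `F` [§1.1 p. 449] -/
  Place : Type u
  /-- «`v` splits in `E`» (else «remains prime») [§1.1 p. 449] -/
  IsSplitPlace : Place → Prop
  /-- «`v` is finite»; archimedean = not finite [§1.4 p. 451 L2–3; «S including the archimedean places» p. 462] -/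
  IsFinitePlace : Place → Prop
  /-- the ★ local dictionary at `v` (`G_v`, `μ_v`, `Π(ϱ_v)`, `πⁿ(ϱ_v)`, `πˢ(ϱ_v)`, local Weil representations) [§1.4 p. 450 L36 – p. 451 L6] -/
  loc : Place → GR91LocalPacket.{u}
  /-- `π ↦ π_v`, the local component («`π = ⊗π_v`») [§1.4 p. 451 L6] -/
  comp : X.Rep → (v : Place) → (loc v).LocRep
  /-- `η ↦ η_v` for automorphic characters of `U(1) = E¹` [§1.4 p. 450 L40] -/
  locChar : X.Char1 → (v : Place) → (loc v).Char1
  /-- `γ ↦ γ_v` for the characters of `I_E` restricting to `ω_{E/F}` (`μ ↦ μ_v`) [§1.4 p. 450 L40] -/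
  locOmega : X.OmegaHecke → (v : Place) → (loc v).OmegaHecke
  /-- `ψ ↦ ψ_v` for additive characters [Lem. 5.1.2 p. 466] -/
  locAdd : X.AddChar → (v : Place) → (loc v).AddChar
  /-- `γ ↦ γ`: characters of `I_E` restricting to `ω_{E/F}` are Hecke characters of `E` [§1.4 p. 450 L20] -/
  ofOmega : X.OmegaHecke → HeckeE
  /-- `ν ↦ ν_E`, `ν_E(α) = ν(α/ᾱ)`, «the base change of `ν` to `GL_{1/E}`» [§1.2 p. 450 L13–14] -/
  bc1 : X.Char1 →* HeckeE
  /-- `ξ ↦ ξ¹`, «the restriction of `ξ` to the norm one elements» (an automorphic character of `U(1)`) [Thm. 5.1.1 p. 465 L21; §4.2 p. 462] -/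
  res1 : HeckeE →* X.Char1
  /-- `ξ ↦ ξ_F`, restriction to `I_F` [(5.1.2) p. 465; §4.1 p. 462] -/
  resF : HeckeE →* HeckeF
  /-- `ω_{E/F}`, «the character `ω_{E/F}` associated to `E/F` by class field theory» [§1.4 p. 450 L21] -/
  omegaEF : HeckeF
  /-- irreducible representations of `GL₃(𝔸_E)` up to isomorphism -/
  RepGL3E : Type u
  /-- «is an automorphic representation of `GL_{3/E}`» [§1.3 p. 450 L16] -/
  IsAutomorphicGL3E : RepGL3E → Prop
  /-- `π ↦ π_E`, the base change to `GL_{3/E}` ([R]) [§1.3 p. 450 L15–16] -/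
  bcG : X.Rep → RepGL3E
  /-- `L(s, Π ⊗ ξ)`, the `GL₃` `L`-function [§1.3 p. 450 L17–18] -/
  LGL3E : RepGL3E → HeckeE → ℂ → ℂ
  /-- `L_S(s, Π ⊗ ξ)`, partial `GL₃` `L`-function off the finite set `S` [Introduction p. 446 L24–27] -/
  LGL3ES : Finset Place → RepGL3E → HeckeE → ℂ → ℂ
  /-- `L_v(s, Π ⊗ ξ)`, the local factor at `v` [proof of Thm. 4.3.1 p. 464] -/
  LGL3Ev : Place → RepGL3E → HeckeE → ℂ → ℂ
  /-- irreducible representations of `GL₂(𝔸_E)` up to isomorphism -/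
  RepGL2E : Type u
  /-- «is an automorphic representation of `GL_{2/E}`» [§1.4 p. 450 L34–35] -/
  IsAutomorphicGL2E : RepGL2E → Prop
  /-- `L(s, ϱ_{2E} ⊗ χ)`, the `GL₂` `L`-function [§1.4 p. 450 L33] -/
  LGL2E : RepGL2E → HeckeE → ℂ → ℂ
  /-- `L_E(s, χ)`, the Hecke `L`-function of a Hecke character `χ` of `E` [§1.4 p. 450 L33; p. 465 L12] -/
  LHecke : HeckeE → ℂ → ℂ
  /-- `L_S(s, χ)`, partial Hecke `L`-function of `E` off `S` [(5.1.2) p. 465] -/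
  LHeckeS : Finset Place → HeckeE → ℂ → ℂ
  /-- `L_v(s, χ)`, local factor at (the places of `E` over) `v` [proof of Thm. 4.3.1 p. 464] -/
  LHeckev : Place → HeckeE → ℂ → ℂ
  /-- `L(s, χ′)`, Hecke `L`-function of a Hecke character `χ′` of `F` [§4.1 p. 462; (5.1.2) p. 465] -/
  LF : HeckeF → ℂ → ℂ
  /-- `L_S(s, χ′)`, partial Hecke `L`-function of `F` off `S` (`L_S(2s+1, ξ_F)`) [(5.1.2) p. 465] -/
  LFS : Finset Place → HeckeF → ℂ → ℂ
  /-- `L_v(s, χ′)`, local factor at `v` of a Hecke character of `F` [proof of Thm. 4.3.1 p. 464] -/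
  LFv : Place → HeckeF → ℂ → ℂ
  /-- `ε(s, χ)`, the `ε`-factor of a Hecke character of `E` [Introduction p. 446 L10] -/
  eps : HeckeE → ℂ → ℂ
  /-- «`π` is cuspidal» [Introduction p. 446 L24] -/
  IsCuspidal : X.Rep → Prop
  /-- `L`-packets `ϱ₂` on `U(2)` [§1.4 p. 450 L28–29] -/
  PacketU2 : Type u
  /-- «discrete» `L`-packet on `U(2)` [§1.4 p. 450 L24] -/
  IsDiscreteU2 : PacketU2 → Prop
  /-- «cuspidal `L`-packet on `H`» (`ϱ = ϱ₂ ⊗ ϱ₁`) [Introduction p. 447 L15] -/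
  IsCuspidalU2 : PacketU2 → Prop
  /-- `dim ϱ₂ = 1` (iff `dim ϱ = 1` for `ϱ = ϱ₂ × ϱ₁`) [§1.4 p. 450 L29, L36] -/
  IsOneDimU2 : PacketU2 → Prop
  /-- `ϱ₂ ↦ ϱ₂ ⊗ (ν ∘ det)`, twist of an `L`-packet on `U(2)` by an automorphic character of `U(1)` [Lem. 6.2.2 p. 469] -/
  twistDetU2 : PacketU2 → X.Char1 → PacketU2
  /-- `ϱ₂ ↦ ϱ_{2E}`, «the base change lift of `ϱ₂` to `GL_{2/E}`» [§1.4 p. 450 L33–35] -/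
  bcU2 : PacketU2 → RepGL2E
  /-- `Π(ϱ)` for `ϱ = ϱ₂ × ϱ₁`, `dim ϱ ≠ 1`: «the `L`-packet on `G` corresponding to `ϱ` with respect to `ξ_H`» [§1.4 p. 450 L29–31] -/
  packetL : PacketU2 → X.Char1 → Set X.Rep
  /-- `Π(ϱ_v)`, the local `L`-packet at `v` of `ϱ = ϱ₂ × ϱ₁`, `dim ϱ ≠ 1` («`Π` is a "tensor product" `⊗Π_v`») [§1.4 p. 450 L26–27; Lem. 6.2.2 p. 469] -/
  locPacketL : (v : Place) → PacketU2 → X.Char1 → Set (loc v).LocRep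

namespace EndoscopicLData

variable {X : GR91Spectrum.{u}} {HeckeE HeckeF : Type u} [CommGroup HeckeE] [CommGroup HeckeF]
  (D : EndoscopicLData X HeckeE HeckeF)

/-- **§1.3 DEFINITION** «For all Hecke characters `ξ` of `E`, the "standard" `L`-function `L(s, π ⊗ ξ)` is, by definition,
the `GL₃` `L`-function `L(s, π_E ⊗ ξ)`.» (`π` discrete; «For a description at the unramified places, cf. [GR₁, §1.2]».)
[cite: GelbartRogawski1991, §1.3 p. 450 L15–19] -/
def Lstd (π : X.Rep) (ξ : HeckeE) (s : ℂ) : ℂ :=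
  D.LGL3E (D.bcG π) ξ s

/-- **`L_S(s, π ⊗ ξ) := L_S(s, π_E ⊗ ξ)`**, the §1.3 definition read for the partial `L`-function of the Introduction
(«`L_S(s, π ⊗ ξ)` is the partial `L`-function with respect to a finite set of places `S`»).
[cite: GelbartRogawski1991, §1.3 p. 450 L15–19; Introduction p. 446 L24–27] -/
def LstdS (S : Finset D.Place) (π : X.Rep) (ξ : HeckeE) (s : ℂ) : ℂ :=
  D.LGL3ES S (D.bcG π) ξ s

/-- **`L_v(s, π ⊗ ξ) := L_v(s, π_E ⊗ ξ)`**, the §1.3 definition read for the local factor at `v` («For a description at the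
unramified places, cf. [GR₁, §1.2]»; the `L_v(s + ½, π ⊗ ξ)` of the proof of Thm. 4.3.1).
[cite: GelbartRogawski1991, §1.3 p. 450 L15–19; proof of Thm. 4.3.1 p. 464] -/
def Lstdv (v : D.Place) (π : X.Rep) (ξ : HeckeE) (s : ℂ) : ℂ :=
  D.LGL3Ev v (D.bcG π) ξ s

end EndoscopicLData

end Literature.NumberTheory.GelbartRogawski1991.Sec1Defs

end
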